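import Mathlib
import Summits.Ventures.PercRepro2.Defs
import Summits.Ventures.PercRepro2.CoinTraceBlock
import Summits.Ventures.PercRepro2.CoinTraceShift
import Summits.Ventures.PercRepro2.CoinTraceBlocks
import Summits.Ventures.PercRepro2.CoinTraceBlocks2

/-!
# The three HARD up-sets of TWO CHAINS OF LENGTH 2 are sign-method blocks (blind cell PercRepro2,
night-2 g4; proofs/NIGHT2-DARC.md §24.3)

`P = {w, p₁, p₂, q₁, q₂}` with the two routes `w → p₁ → p₂ → t`, `w → q₁ → q₂ → t` (so `p₁ ∈ Z ⟹
p₂ ∈ Z`, `q₁ ∈ Z ⟹ q₂ ∈ Z`, and `w ∈ Z` forces a full route); pivotal traces `A = wp₁p₂`,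
`B = wq₁q₂`, `C = wp₁p₂q₂`, `D = wp₂q₁q₂`, `E = P`.  The union-type up-sets `{C, E}`
(`twoChains_hard_block_nonneg`, the pattern of NIGHT2-DARC.md §15.15 that had no LP certificate;
by symmetry also `{D, E}`) and `{C, D, E}` (`twoChains_hardCD_block_nonneg`) have nonnegative
blocks by the three-case argument of §23: `H_C = 𝒩_{wp₁} ⊔ {p₁p₂} ⊔ 𝒱_{p₁q₂}` with the case on the
pivotal data at `A`, and `H_CD = 𝒩_{wq₂} ⊔ {q₂, q₁q₂} ⊔ 𝒱_{p₂q₂}` with the case at `B` (its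
«below» case reduces to `H_C`).  The pair-cylinder inputs are the hypotheses `hCU`, supplied by
`trace_cu_pa_pair` / `trace_cu_pa_pair₂` (CoinTracePinTransfer.lean).
-/

namespace Summit.Ventures.PercRepro2.Coin

section TwoChainsHard

open Classical

variable {V : Type*} [DecidableEq V] {R : Type*} [Field R] [LinearOrder R] [IsStrictOrderedRing R]

omit [DecidableEq V] [LinearOrder R] [IsStrictOrderedRing R] in
/-- Two filters give the same sum when their predicates agree on the traces with a nonzero term. -/
lemma sum_filter_congr_of_ne_zero (S : Finset (Finset V)) (f : Finset V → R)
    (p q : Finset V → Prop) [DecidablePred p] [DecidablePred q]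
    (h : ∀ Z ∈ S, f Z ≠ 0 → (p Z ↔ q Z)) :
    ∑ Z ∈ S.filter p, f Z = ∑ Z ∈ S.filter q, f Z := by
  rw [Finset.sum_filter, Finset.sum_filter]
  refine Finset.sum_congr rfl fun Z hZ => ?_
  by_cases hf : f Z = 0
  · rw [hf]; simp
  · have := h Z hZ hf
    by_cases hp : p Z
    · rw [if_pos hp, if_pos (this.mp hp)]
    · rw [if_neg hp, if_neg (fun hq => hp (this.mpr hq))]

/-- **The hard block `{C, E}` of two chains** (and, with the routes swapped, `{D, E}`). -/
theorem twoChains_hard_block_nonneg (P : Finset V) {w p₁ p₂ q₁ q₂ : V}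
    (hwP : w ∈ P) (hp₁P : p₁ ∈ P) (hp₂P : p₂ ∈ P) (hq₁P : q₁ ∈ P) (hq₂P : q₂ ∈ P)
    (hPel : ∀ z ∈ P, z = w ∨ z = p₁ ∨ z = p₂ ∨ z = q₁ ∨ z = q₂)
    (hwp₁ : w ≠ p₁) (hwp₂ : w ≠ p₂) (hwq₁ : w ≠ q₁) (hwq₂ : w ≠ q₂) (hp₁₂ : p₁ ≠ p₂)
    (hp₁q₁ : p₁ ≠ q₁) (hp₁q₂ : p₁ ≠ q₂) (hp₂q₁ : p₂ ≠ q₁) (hp₂q₂ : p₂ ≠ q₂) (hq₁₂ : q₁ ≠ q₂)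
    (μ x y xh yh : Finset V → R) (hμ : ∀ Z ∈ P.powerset, 0 ≤ μ Z)
    (hμ0a : ∀ Z ∈ P.powerset, p₁ ∈ Z → p₂ ∉ Z → μ Z = 0)
    (hμ0b : ∀ Z ∈ P.powerset, q₁ ∈ Z → q₂ ∉ Z → μ Z = 0)
    (hμ0c : ∀ Z ∈ P.powerset, w ∈ Z → ¬ (p₁ ∈ Z ∧ p₂ ∈ Z) → ¬ (q₁ ∈ Z ∧ q₂ ∈ Z) → μ Z = 0)
    (hx1 : ∀ Z : Finset V, Z ⊆ P → x Z ≤ 1) (hy1 : ∀ Z : Finset V, Z ⊆ P → y Z ≤ 1)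
    (hxh1 : ∀ Z : Finset V, Z ⊆ P → xh Z ≤ 1) (hyh1 : ∀ Z : Finset V, Z ⊆ P → yh Z ≤ 1)
    (hxanti : ∀ Z Z' : Finset V, Z ⊆ Z' → Z' ⊆ P → x Z' ≤ x Z)
    (hyanti : ∀ Z Z' : Finset V, Z ⊆ Z' → Z' ⊆ P → y Z' ≤ y Z)
    (hxhanti : ∀ Z Z' : Finset V, Z ⊆ Z' → Z' ⊆ P → xh Z' ≤ xh Z)
    (hyhanti : ∀ Z Z' : Finset V, Z ⊆ Z' → Z' ⊆ P → yh Z' ≤ yh Z)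
    (hxh_le : ∀ Z : Finset V, Z ⊆ P → xh Z ≤ x Z) (hyh_le : ∀ Z : Finset V, Z ⊆ P → yh Z ≤ y Z)
    (hxh_eq : ∀ Z : Finset V, Z ⊆ P → w ∉ Z → xh Z = x Z)
    (hyh_eq : ∀ Z : Finset V, Z ⊆ P → w ∉ Z → yh Z = y Z)
    (hPA : TracePA P μ) (hCUp₁ : TraceCUPA P μ p₁)
    (hCU : ∀ f₁ f₂ : Finset V → R,
      (∀ Z Z' : Finset V, Z ⊆ Z' → Z' ⊆ P → f₁ Z ≤ f₁ Z') →
      (∀ Z Z' : Finset V, Z ⊆ Z' → Z' ⊆ P → f₂ Z ≤ f₂ Z') →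
      (∀ Z : Finset V, Z ⊆ P → 0 ≤ f₁ Z) → (∀ Z : Finset V, Z ⊆ P → 0 ≤ f₂ Z) →
      (∑ Z ∈ P.powerset.filter (fun Z => p₁ ∈ Z ∧ q₂ ∈ Z), f₁ Z * μ Z) *
          (∑ Z ∈ P.powerset.filter (fun Z => p₁ ∈ Z ∧ q₂ ∈ Z), f₂ Z * μ Z) ≤
        (∑ Z ∈ P.powerset.filter (fun Z => p₁ ∈ Z ∧ q₂ ∈ Z), f₁ Z * f₂ Z * μ Z) *
          ∑ Z ∈ P.powerset.filter (fun Z => p₁ ∈ Z ∧ q₂ ∈ Z), μ Z) :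
    0 ≤ ∑ Z ∈ P.powerset.filter (fun Z => Disjoint Z {w} ∨ (p₁ ∈ Z ∧ q₂ ∈ Z)),
      μ Z * (xh Z * (∑ Z' ∈ P.powerset, μ Z') - ∑ Z' ∈ P.powerset, x Z' * μ Z') *
        (yh Z * (∑ Z' ∈ P.powerset, μ Z') - ∑ Z' ∈ P.powerset, y Z' * μ Z') := by
  have hAP : ({w, p₁, p₂} : Finset V) ⊆ P := by
    intro z hz
    simp only [Finset.mem_insert, Finset.mem_singleton] at hz
    rcases hz with rfl | rfl | rfl <;> assumption
  have hwp₁P : ({w, p₁} : Finset V) ⊆ P := by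
    intro z hz
    simp only [Finset.mem_insert, Finset.mem_singleton] at hz
    rcases hz with rfl | rfl <;> assumption
  obtain ⟨Λ, hΛ⟩ : ∃ L : R, L = ∑ Z ∈ P.powerset, μ Z := ⟨_, rfl⟩
  obtain ⟨MX, hMX⟩ : ∃ M : R, M = ∑ Z ∈ P.powerset, x Z * μ Z := ⟨_, rfl⟩
  obtain ⟨MY, hMY⟩ : ∃ M : R, M = ∑ Z ∈ P.powerset, y Z * μ Z := ⟨_, rfl⟩
  have hΛn : 0 ≤ Λ := by rw [hΛ]; exact Finset.sum_nonneg hμ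
  rw [← hΛ, ← hMX, ← hMY]
  set T : Finset V → R := fun Z => μ Z * (xh Z * Λ - MX) * (yh Z * Λ - MY) with hTdef
  show 0 ≤ ∑ Z ∈ P.powerset.filter (fun Z => Disjoint Z {w} ∨ (p₁ ∈ Z ∧ q₂ ∈ Z)), T Z
  -- the blocks available in every case
  have hV₁ : 0 ≤ ∑ Z ∈ P.powerset.filter (fun Z => Disjoint Z {w} ∨ p₁ ∈ Z), T Z := by
    have h := cylinder_block_nonneg P hwP hp₁P μ x y xh yh hμ hx1 hy1 hxh1 hyh1 hxanti hyanti
      hxhanti hyhanti hxh_le hyh_le hxh_eq hyh_eq hPA hCUp₁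
    rw [← hΛ, ← hMX, ← hMY] at h
    exact h
  have hTop : 0 ≤ ∑ Z ∈ P.powerset.filter (fun Z => Disjoint Z {w} ∨ Z = P), T Z := by
    have h := top_block_nonneg P hwP μ x y xh yh hμ hx1 hy1 hxh1 hyh1 hxanti hyanti hxhanti
      hyhanti hxh_le hyh_le hxh_eq hyh_eq hPA
    rw [← hΛ, ← hMX, ← hMY] at h
    exact h
  have hAv : 0 ≤ ∑ Z ∈ P.powerset.filter (fun Z => Disjoint Z {w, p₁}), T Z := by
    have h := avoidU_block_nonneg P {w, p₁} (by simp) hwp₁P μ x y xh yh hμ hx1 hy1 hxh1 hyh1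
      hxanti hyanti hxhanti hyhanti hxh_eq hyh_eq hPA
    rw [← hΛ, ← hMX, ← hMY] at h
    exact h
  have hCyl : 0 ≤ ∑ Z ∈ P.powerset.filter (fun Z => p₁ ∈ Z ∧ q₂ ∈ Z), T Z := by
    have h := cylinder₂_block_nonneg P μ x y xh yh hμ hx1 hy1 hxh1 hyh1 hxanti hyanti hxhanti
      hyhanti hxh_le hyh_le hPA hCU
    rw [← hΛ, ← hMX, ← hMY] at h
    exact h
  -- the pivotal data at `A = {w, p₁, p₂}`
  set A : Finset V := {w, p₁, p₂} with hAdef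
  have hApow : A ∈ P.powerset := Finset.mem_powerset.mpr hAP
  have hμA : 0 ≤ μ A := hμ A hApow
  -- a trace with `w, p₁ ∈ Z`, `q₂ ∉ Z` and positive mass is `A`
  have hisA : ∀ Z ∈ P.powerset, w ∈ Z → p₁ ∈ Z → q₂ ∉ Z → μ Z ≠ 0 → Z = A := by
    intro Z hZpow hwZ hp₁Z hq₂Z hμZ
    have hZP : Z ⊆ P := Finset.mem_powerset.mp hZpow
    have hp₂Z : p₂ ∈ Z := by
      by_contra h; exact hμZ (hμ0a Z hZpow hp₁Z h)
    have hq₁Z : q₁ ∉ Z := fun h => hμZ (hμ0b Z hZpow h hq₂Z)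
    apply Finset.Subset.antisymm
    · intro z hz
      rcases hPel z (hZP hz) with rfl | rfl | rfl | rfl | rfl
      · simp [hAdef]
      · simp [hAdef]
      · simp [hAdef]
      · exact absurd hz hq₁Z
      · exact absurd hz hq₂Z
    · intro z hz
      simp only [hAdef, Finset.mem_insert, Finset.mem_singleton] at hz
      rcases hz with rfl | rfl | rfl
      · exact hwZ
      · exact hp₁Z
      · exact hp₂Z
  by_cases hTA : (xh A * Λ - MX) * (yh A * Λ - MY) ≤ 0
  · -- CASE 1: `T̂_A ≤ 0`: `G(H_C) = G(𝒩_w ∪ 𝒱_{p₁}) − (terms at w, p₁ ∈ Z, q₂ ∉ Z)`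
    have hsplit := Finset.sum_filter_add_sum_filter_not
      (P.powerset.filter (fun Z => Disjoint Z {w} ∨ p₁ ∈ Z)) (fun Z => q₂ ∈ Z ∨ Disjoint Z {w}) T
    have e1 : (P.powerset.filter (fun Z => Disjoint Z {w} ∨ p₁ ∈ Z)).filter
        (fun Z => q₂ ∈ Z ∨ Disjoint Z {w}) =
        P.powerset.filter (fun Z => Disjoint Z {w} ∨ (p₁ ∈ Z ∧ q₂ ∈ Z)) := by
      rw [Finset.filter_filter]
      refine Finset.filter_congr fun Z _ => ?_
      constructor
      · rintro ⟨h1 | h1, h2 | h2⟩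
        · exact Or.inl h1
        · exact Or.inl h2
        · exact Or.inr ⟨h1, h2⟩
        · exact Or.inl h2
      · rintro (h | ⟨h1, h2⟩)
        · exact ⟨Or.inl h, Or.inr h⟩
        · exact ⟨Or.inr h1, Or.inl h2⟩
    rw [e1] at hsplit
    have hrest : ∑ Z ∈ (P.powerset.filter (fun Z => Disjoint Z {w} ∨ p₁ ∈ Z)).filter
        (fun Z => ¬ (q₂ ∈ Z ∨ Disjoint Z {w})), T Z ≤ 0 := by
      refine Finset.sum_nonpos fun Z hZ => ?_
      rw [Finset.mem_filter, Finset.mem_filter] at hZ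
      obtain ⟨⟨hZpow, hZ1⟩, hZ2⟩ := hZ
      have hq₂Z : q₂ ∉ Z := fun h => hZ2 (Or.inl h)
      have hwZ : w ∈ Z := by
        by_contra hw
        exact hZ2 (Or.inr (Finset.disjoint_singleton_right.mpr hw))
      have hp₁Z : p₁ ∈ Z := by
        rcases hZ1 with h | h
        · exact absurd (Finset.disjoint_singleton_right.mp h) (fun h' => h' hwZ)
        · exact h
      by_cases hμZ : μ Z = 0
      · show μ Z * (xh Z * Λ - MX) * (yh Z * Λ - MY) ≤ 0
        rw [hμZ]; simp
      · have hZA := hisA Z hZpow hwZ hp₁Z hq₂Z hμZ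
        show μ Z * (xh Z * Λ - MX) * (yh Z * Λ - MY) ≤ 0
        rw [hZA, mul_assoc]
        exact mul_nonpos_of_nonneg_of_nonpos hμA hTA
    linarith [hsplit, hV₁, hrest]
  · have hTApos : 0 < (xh A * Λ - MX) * (yh A * Λ - MY) := lt_of_not_ge hTA
    rcases pos_and_pos_or_neg_and_neg_of_mul_pos hTApos with ⟨hxA, hyA⟩ | ⟨hxA, hyA⟩
    · -- CASE 3: `A` above both means: `H_C = 𝒩_{wp₁} ⊔ {Z ∌ w : p₁ ∈ Z, q₂ ∉ Z} ⊔ 𝒱_{p₁q₂}`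
      have hsplit := Finset.sum_filter_add_sum_filter_not
        (P.powerset.filter (fun Z => Disjoint Z {w} ∨ (p₁ ∈ Z ∧ q₂ ∈ Z)))
        (fun Z => Disjoint Z {w, p₁}) T
      have e1 : (P.powerset.filter (fun Z => Disjoint Z {w} ∨ (p₁ ∈ Z ∧ q₂ ∈ Z))).filter
          (fun Z => Disjoint Z {w, p₁}) = P.powerset.filter (fun Z => Disjoint Z {w, p₁}) := by
        rw [Finset.filter_filter]
        refine Finset.filter_congr fun Z _ => ?_
        constructor
        · exact fun h => h.2
        · intro h
          exact ⟨Or.inl (Finset.disjoint_of_subset_right (by simp) h), h⟩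
      have hsplit2 := Finset.sum_filter_add_sum_filter_not
        ((P.powerset.filter (fun Z => Disjoint Z {w} ∨ (p₁ ∈ Z ∧ q₂ ∈ Z))).filter
          (fun Z => ¬ Disjoint Z {w, p₁})) (fun Z => p₁ ∈ Z ∧ q₂ ∈ Z) T
      have e2 : ((P.powerset.filter (fun Z => Disjoint Z {w} ∨ (p₁ ∈ Z ∧ q₂ ∈ Z))).filter
          (fun Z => ¬ Disjoint Z {w, p₁})).filter (fun Z => p₁ ∈ Z ∧ q₂ ∈ Z) =
          P.powerset.filter (fun Z => p₁ ∈ Z ∧ q₂ ∈ Z) := by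
        rw [Finset.filter_filter, Finset.filter_filter]
        refine Finset.filter_congr fun Z _ => ?_
        constructor
        · exact fun h => h.2.2
        · intro h
          refine ⟨Or.inr h, ?_, h⟩
          intro hd
          exact (Finset.disjoint_left.mp hd h.1) (by simp)
      rw [e2] at hsplit2
      rw [e1] at hsplit
      have hmid : 0 ≤ ∑ Z ∈ ((P.powerset.filter (fun Z => Disjoint Z {w} ∨ (p₁ ∈ Z ∧ q₂ ∈ Z))).filter
          (fun Z => ¬ Disjoint Z {w, p₁})).filter (fun Z => ¬ (p₁ ∈ Z ∧ q₂ ∈ Z)), T Z := by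
        refine Finset.sum_nonneg fun Z hZ => ?_
        rw [Finset.mem_filter, Finset.mem_filter, Finset.mem_filter] at hZ
        obtain ⟨⟨⟨hZpow, hZ1⟩, hZ2⟩, hZ3⟩ := hZ
        have hwZ : w ∉ Z := by
          rcases hZ1 with h | h
          · exact Finset.disjoint_singleton_right.mp h
          · exact absurd h hZ3
        have hp₁Z : p₁ ∈ Z := by
          by_contra h
          exact hZ2 (Finset.disjoint_insert_right.mpr
            ⟨hwZ, Finset.disjoint_singleton_right.mpr h⟩)
        have hq₂Z : q₂ ∉ Z := fun h => hZ3 ⟨hp₁Z, h⟩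
        have hZP : Z ⊆ P := Finset.mem_powerset.mp hZpow
        by_cases hμZ : μ Z = 0
        · show 0 ≤ μ Z * (xh Z * Λ - MX) * (yh Z * Λ - MY)
          rw [hμZ]; simp
        · have hq₁Z : q₁ ∉ Z := fun h => hμZ (hμ0b Z hZpow h hq₂Z)
          have hZA : Z ⊆ A := by
            intro z hz
            rcases hPel z (hZP hz) with rfl | rfl | rfl | rfl | rfl
            · exact absurd hz hwZ
            · simp [hAdef]
            · simp [hAdef]
            · exact absurd hz hq₁Z
            · exact absurd hz hq₂Z
          have hxZ : xh A * Λ - MX ≤ xh Z * Λ - MX := by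
            rw [hxh_eq Z hZP hwZ]
            have h1 : x A ≤ x Z := hxanti Z A hZA hAP
            have h2 : xh A ≤ x A := hxh_le A hAP
            nlinarith [mul_le_mul_of_nonneg_right (h2.trans h1) hΛn]
          have hyZ : yh A * Λ - MY ≤ yh Z * Λ - MY := by
            rw [hyh_eq Z hZP hwZ]
            have h1 : y A ≤ y Z := hyanti Z A hZA hAP
            have h2 : yh A ≤ y A := hyh_le A hAP
            nlinarith [mul_le_mul_of_nonneg_right (h2.trans h1) hΛn]
          show 0 ≤ μ Z * (xh Z * Λ - MX) * (yh Z * Λ - MY)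
          rw [mul_assoc]
          exact mul_nonneg (hμ Z hZpow) (mul_nonneg (by linarith) (by linarith))
      linarith [hsplit, hsplit2, hAv, hCyl, hmid]
    · -- CASE 2: `A` below both means: the pivotal traces `⊇ A` have nonnegative terms
      have hsplit := Finset.sum_filter_add_sum_filter_not
        (P.powerset.filter (fun Z => Disjoint Z {w} ∨ (p₁ ∈ Z ∧ q₂ ∈ Z)))
        (fun Z => Disjoint Z {w} ∨ Z = P) T
      have e1 : (P.powerset.filter (fun Z => Disjoint Z {w} ∨ (p₁ ∈ Z ∧ q₂ ∈ Z))).filter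
          (fun Z => Disjoint Z {w} ∨ Z = P) = P.powerset.filter (fun Z => Disjoint Z {w} ∨ Z = P) := by
        rw [Finset.filter_filter]
        refine Finset.filter_congr fun Z _ => ?_
        constructor
        · exact fun h => h.2
        · rintro (h | h)
          · exact ⟨Or.inl h, Or.inl h⟩
          · exact ⟨Or.inr ⟨h ▸ hp₁P, h ▸ hq₂P⟩, Or.inr h⟩
      rw [e1] at hsplit
      have hrest : 0 ≤ ∑ Z ∈ (P.powerset.filter (fun Z => Disjoint Z {w} ∨ (p₁ ∈ Z ∧ q₂ ∈ Z))).filter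
          (fun Z => ¬ (Disjoint Z {w} ∨ Z = P)), T Z := by
        refine Finset.sum_nonneg fun Z hZ => ?_
        rw [Finset.mem_filter, Finset.mem_filter] at hZ
        obtain ⟨⟨hZpow, hZ1⟩, hZ2⟩ := hZ
        have hwZ : w ∈ Z := by
          by_contra hw
          exact hZ2 (Or.inl (Finset.disjoint_singleton_right.mpr hw))
        have hp₁Z : p₁ ∈ Z := by
          rcases hZ1 with h | h
          · exact absurd (Finset.disjoint_singleton_right.mp h) (fun h' => h' hwZ)
          · exact h.1
        have hZP : Z ⊆ P := Finset.mem_powerset.mp hZpow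
        by_cases hμZ : μ Z = 0
        · show 0 ≤ μ Z * (xh Z * Λ - MX) * (yh Z * Λ - MY)
          rw [hμZ]; simp
        · have hp₂Z : p₂ ∈ Z := by
            by_contra h; exact hμZ (hμ0a Z hZpow hp₁Z h)
          have hAZ : A ⊆ Z := by
            intro z hz
            simp only [hAdef, Finset.mem_insert, Finset.mem_singleton] at hz
            rcases hz with rfl | rfl | rfl
            · exact hwZ
            · exact hp₁Z
            · exact hp₂Z
          have hxZ : xh Z * Λ - MX ≤ xh A * Λ - MX := by
            have h1 : xh Z ≤ xh A := hxhanti A Z hAZ hZP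
            nlinarith [mul_le_mul_of_nonneg_right h1 hΛn]
          have hyZ : yh Z * Λ - MY ≤ yh A * Λ - MY := by
            have h1 : yh Z ≤ yh A := hyhanti A Z hAZ hZP
            nlinarith [mul_le_mul_of_nonneg_right h1 hΛn]
          show 0 ≤ μ Z * (xh Z * Λ - MX) * (yh Z * Λ - MY)
          rw [mul_assoc]
          exact mul_nonneg (hμ Z hZpow)
            (mul_nonneg_of_nonpos_of_nonpos (by linarith) (by linarith))
      linarith [hsplit, hTop, hrest]


end TwoChainsHard

end Summit.Ventures.PercRepro2.Coin
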